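/-
Origin: expansion seat `planner-pub-hodgecm-carver-0`, handover 2026-08-18T03:27:49Z (synced 03:34:05Z) (`HOME/pub-hodgecm-carver/lean/Carver/PerL34/Chars.lean`, md5 0d9cd315, 83 lines);
landed by the gen-5 packager in gate run 18 as `HodgeCM/PerL34/Chars.lean` (verbatim).
-/
/-
Origin: HOME/pub-hodgecm-carver/lean/HodgeCM/PerL34/Chars.lean — session planner-pub-hodgecm-carver-0 (unit
pub-hodgecm-carver, THE CARVER).  Intended final place: `HodgeCM/PerL34/Chars.lean`.
DAG nodes (HOME/LEMMAS.md §1): N30 (Lemma 4.2(a)), N31 (Lemma 4.2(b) = hypothesis 1 of Thm 3.7 = `H_chars`) with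
its proof steps N31a–N31h, N32 (Lemma 4.2(c)).  Nothing is asserted.
-/
import Summits.HodgeConjecture.HodgeCM.Automorphic.ThetaFacts

set_option autoImplicit false

/-!
# PerL v5 §4.2 — characters and non-vanishing (DAG nodes N30–N32)

* **N30** (Lemma 4.2(a), tex ll. 528–529): existence of automorphic characters of `[U(1)]` with prescribed
  exponents.  The package has no `𝔸¹_L` vocabulary (LEMMAS.md §3 D3); its arithmetic CORE — Kronecker's theorem
  "an algebraic integer all of whose conjugates have absolute value 1 is a root of unity" (l. 539) — is typed below
  as `N30_core_kronecker` (Mathlib-provable now: `NumberField.Embeddings.pow_eq_one_of_norm_eq_one`).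
* **N31** (Lemma 4.2(b), ll. 529–532): typed as `N31_chars` (= `Open_chars`).  The three consecutive FIRST
  ERRORS of the reviews (R2, R3, R4) all sit inside ITS PROOF (LEMMAS.md §6).  Second layer: `N31_split` = an
  instance of the prior programme's `RallisDatum`/`CharsDischarge` (Euler-product skeleton, kernel-checked
  `Perl34.C4.CharsDischarge.H_chars`) whose FIELDS are the sub-steps N31e (`AX7_factor`: Rallis inner product
  formula, ll. 588–608), N31f (`ram_pos`: local factors, ll. 608–623), N31g (`AX7_nonsplit_val`/`AX7_split_val`:
  unramified places, ll. 623–631), N31h (`AX7_tail`, `allowed_of_theta`: Euler product and constituents,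
  ll. 631–635); N31a–N31d (local occurrence, doubling set-up, (eq:basic), Weil's Siegel–Weil) are the print inputs
  BEHIND `AX7_factor` and are not separately typeable today (D4).  The topological core of N31g — "the circle has
  no small subgroups" (ll. 623–626, the R2 repair) — is typed as `N31g_core_noSmallSubgroups` (Mathlib-provable now).
* **N32** (Lemma 4.2(c), ll. 533–534): `U_{t^i}(S(K_f)) ≠ 0`; in the package the consumed form is the THEOREM
  `ThetaRealisation.supply` (derived from `lineField`, run 12) — nothing to do.
-/

noncomputable section

namespace HodgeCM
namespace PerL34

open HodgeCM.Prior.Perl34File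

variable {U : Universe} (T : U.ThetaModel)

/-- **N30 core** (PerL v5 Lemma 4.2(a) proof, tex ll. 537–539): "its intersection with
`\U(1)(L_0\otimes\R)\times K'` … consists of elements of `\mathcal O_L^\times` all of whose conjugates have absolute
value `1`, i.e.\ of roots of unity (Kronecker)".  PRINT (Kronecker 1857); in Mathlib. -/
def N30_core_kronecker : Prop :=
  ∀ (K : Type) [Field K] [NumberField K] (x : K), IsIntegral ℤ x →
    (∀ φ : K →+* ℂ, ‖φ x‖ = 1) → ∃ n : ℕ, 0 < n ∧ x ^ n = 1

/-- **N31** (PerL v5 Lemma 4.2(b) `lem:chars`, tex ll. 529–532): "If `(W_i,\mu_i)` have the forced signs and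
infinity type of type `\Psi_i` (Definition~\ref{def:allowed}) and `\chi'_i` has infinity type `e(\Psi_i)`
(Lemma~\ref{lem:arch}(a)), then the theta space `\pi_i:=\Theta^{W_i}_{\mu_i}(\chi'_i)` is non-zero and every
irreducible constituent `\sigma` of its closure lies in `\cA^{1,0}` …; i.e.\ `(W_i,\mu_i,\chi'_i)` is allowed."
Typed in the form consumed by Prop 3.6 / Thm 3.7 (every character of type `w` / `w'` is allowed); = `Open_chars`.
INTERNAL over PRINT ([GQT §11.3], [Li92 Thm 2.1], [We65 Thm 5], [SZ Thm 1.10], [HKS]). -/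
def N31_chars : Prop := T.Open_chars

/-- (Ported verbatim from the HodgeCMPerL package; no docstring in the source.) -/
theorem N31_iff : N31_chars T ↔ T.Open_chars := Iff.rfl

/-- **Honest split of N31** (second layer, PerL ll. 548–635): in every good context, for some index type of
places, a `CharsDischarge` package (a Rallis chain per character + the bridge "θ ≠ 0 ⇒ allowed") for BOTH torus
sides.  Fields ↔ sub-nodes: `RallisDatum.AX7_factor` = N31e, `ram_pos` = N31f, `AX7_split_val`/`AX7_nonsplit_val`
= N31g, `AX7_tail` + `CharsDischarge.innerSelf_eq`/`allowed_of_theta` = N31h.  The implication to N31 is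
kernel-checked (`Perl34.C4.CharsDischarge.H_chars`: positive Euler product ⇒ `θ_φ(χ') ≠ 0` ⇒ allowed). -/
def N31_split : Prop :=
  ∀ {L : CMField} {ι₁ : L →+* ℂ} (V : HermSpace3 L ι₁) (c : SeesawCtx L), T.GoodCtx ι₁ c →
    ∃ Pl : Type, Nonempty (Perl34.C4.CharsDischarge (T.t12 V c) Pl) ∧
      Nonempty (Perl34.C4.CharsDischarge (T.t34 V c) Pl)

/-- (Ported verbatim from the HodgeCMPerL package; no docstring in the source.) -/
theorem N31_of_charsDischarge (h : N31_split T) : N31_chars T := by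
  intro L ι₁ V c hc
  obtain ⟨Pl, ⟨P12⟩, ⟨P34⟩⟩ := h V c hc
  exact ⟨P12.H_chars, P34.H_chars⟩

/-- **N31g core** (PerL v5 Lemma 4.2(b) proof, tex ll. 623–626 — the v2→v3 repair of review R2's FIRST ERROR):
"by continuity `\chi'` maps a neighbourhood of `1` … into an open arc of the circle of length `<\pi`; the image of
that subgroup is a subgroup of the circle contained in the arc, hence trivial (the circle has no small
subgroups)".  Typed for the unit circle of `ℂ`: there is a neighbourhood of `1` containing no non-trivial
subgroup.  Mathlib-provable now. -/
def N31g_core_noSmallSubgroups : Prop :=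
  ∃ W ∈ nhds (1 : Circle), ∀ H : Subgroup Circle, (H : Set Circle) ⊆ W → H = ⊥

end PerL34
end HodgeCM

end
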